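import Literature.AlgebraicGeometry.GroupSchemes.FrobeniusKernelUnitComponent      -- ★ layer criterion `comp_comp_relFrobeniusOver_eq_one_iff_unit`, `comp_relFrobeniusOver_eq_one_iff_unit`, `isClosedImmersion_kerι_relFrobeniusOver_left`
import Literature.AlgebraicGeometry.GroupSchemes.HopfIdealOfClosedSubgroup         -- ★ `exists_iso_comp_quotIncl_ker_appTop_eq`, `quotIncl`
import HarnessLib

/-!
# The Frobenius kernel ALONG A MONOMORPHIC HOMOMORPHISM `ι : G₀ ↪ X`: «`t ≫ ι` killed by `F_X` ⟺ `t` killed by `F_{G₀}` ⟺ `t ∈ Spec (Γ(G₀) ⧸ ker Γ(ι_{Ker F}))`»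
# ([SGA3I] VII_A 4.1; [GortzWedhorn2020] Def. 4.45 (2); [Waterhouse1979] §2.1)

Topic `Literature/AlgebraicGeometry/GroupSchemes`; namespace `Literature.AlgebraicGeometry.GroupSchemes` (continues ★ `FrobeniusKernelUnitComponent` §2 and ★
`HopfIdealOfClosedSubgroup` §5).  THEOREMS ONLY (no definition, no named fact, no instance, no notation, no `sorry`).  Cell `hodgecm-mathlib` (D-0151), P6
«MOD programme» (crux hLiu418 = stmt-HodgeConjecture-24832, `--supports`, count-neutral), half-A line L3 (socket `stub_ROOF0`, (R3) `c•w` kernel reading;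
LA3-plan (g2) deal (hF) «DOCK FROBENIUS LAW» 2026-09-02T06:57:17Z, A-p03 (g31) recipe): the binder `hF` of the (R3) glue `hlaw_cw_of_dockClauses`
(`F0/P6/A-p03/g31/F0P6aRoofCwKernel.v1.A-p03g31.lean` :168–:172) — «`t ≫ ι₀G ≫ F_q(A_x̄) = 1 ↔ ∃ s, s ≫ quotIncl G₀ (kerFI p f G₀) = t`» — GENERICALLY, so
that the S-glue at the dock is ONE `exact` (`ι := (𝔡 x̄).ι₀G`, `kerFI p f G₀ = ker Γ(kerι (F_{G₀}))` by `rfl`).  HONEST LABEL: HC_CM is proved only modulo the 2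
remaining named inputs (hLiu418 24832, h413 24833) until rung 0 closes; this file is generic and discharges none of them.

THE MATHEMATICS.  `k` a field of exponential characteristic `p`, `q = p^f`; `ι : G₀ → X` a homomorphism of `k`-group schemes with `ι.left` a monomorphism
(a closed subgroup).  (hF-b) For a `T`-point `t` of `G₀`: `(t ≫ ι) ≫ F^{(f)}_{X∕k} = 1 ⟺ t ≫ F^{(f)}_{G₀∕k} = 1` — both sides are the SAME unit-section
criterion «`F^{abs,f}_T ≫ t = (T → Spec k) ≫ Frob^f ≫ e_{G₀}`» (★ `comp_comp_relFrobeniusOver_eq_one_iff_unit` ∕ ★ `comp_relFrobeniusOver_eq_one_iff_unit`: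
the relative Frobenius is natural and `e_X = e_{G₀} ≫ ι`); [SGA3I] VII_A 4.1.  (hF-a) For `G₀` affine and finite: `t ≫ F^{(f)}_{G₀∕k} = 1 ⟺ t` factors through the
closed subscheme `Spec (Γ(G₀) ⧸ 𝔎) ↪ G₀`, `𝔎 := ker Γ(ι_{Ker F})` the IDEAL of the Frobenius kernel (★ `exists_iso_comp_quotIncl_ker_appTop_eq`: `Ker F ≅ Spec (Γ(G₀) ⧸ 𝔎)`
over `G₀`; ★ `isClosedImmersion_kerι_relFrobeniusOver_left`); [Waterhouse1979] §2.1.  HEAD (hF) = (b) ∘ (a).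

* §1 `comp_comp_relFrobeniusOver_eq_one_iff_comp_relFrobeniusOver_eq_one` (hF-b);
* §2 `comp_relFrobeniusOver_eq_one_iff_exists_comp_quotIncl` (hF-a);
* §3 HEAD **`comp_comp_relFrobeniusOver_eq_one_iff_exists_comp_quotIncl`** (hF).

## References
* [SGA3I] M. Demazure, A. Grothendieck, *SGA 3* I, Exp. VII_A (P. Gabriel), 4.1.
* [GortzWedhorn2020] U. Görtz, T. Wedhorn, *Algebraic Geometry I*, 2nd ed. (2020), Def. 4.45 (2) (p. 117).
* [Waterhouse1979] W. C. Waterhouse, *Introduction to Affine Group Schemes*, GTM 66 (1979), §2.1.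
-/

set_option autoImplicit false

-- Mathlib's `Over`/`Scheme` APIs are stated across semireducible wrappers (as in the ★ `GroupSchemes/*` files).
set_option backward.isDefEq.respectTransparency false

-- As in ★ `FrobeniusKernelUnitComponent` ∕ ★ (FKw): statements of the shape `c ≫ F^t = 1` need the slow `One (T ⟶ G^{(p^t)})` instance search
-- (Mathlib's scoped `Hom.monoid` through the transported structure of the twist); no proof `maxHeartbeats` budget is raised.
set_option synthInstance.maxHeartbeats 200000

noncomputable section

universe u

open CategoryTheory CategoryTheory.Limits AlgebraicGeometry MonoidalCategory CartesianMonoidalCategory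
open scoped MonObj Obj

namespace Literature.AlgebraicGeometry.GroupSchemes

open Literature.AlgebraicGeometry.Motives GroupSchemeKernel AffineGroupScheme

variable {k : Type u} [Field k] (p : ℕ) [ExpChar k p] (f : ℕ) {G₀ X : SchemeOver k} [GrpObj G₀] [GrpObj X] (jG : G₀ ⟶ X) [IsMonHom jG]

/-! ## §1 (hF-b) `t ≫ ι` killed by `F_X` iff `t` killed by `F_{G₀}` -/

set_option maxHeartbeats 400000 in
/-- **(hF-b) THE FROBENIUS KERNEL ALONG A MONOMORPHIC HOMOMORPHISM**: for `ι : G₀ → X` a homomorphism with `ι.left` mono and a `T`-point `t` of `G₀`,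
`(t ≫ ι) ≫ F^{(f)}_{X∕k} = 1 ↔ t ≫ F^{(f)}_{G₀∕k} = 1` (both are the unit-section criterion ★ `comp_relFrobeniusOver_eq_one_iff_unit`, which does not see the
ambient group: `e_X = e_{G₀} ≫ ι`).  (Budget 400 000: the two `1`s live in two transported twists, as in ★ `FrobeniusKernelUnitComponent` §3.)
[cite: SGA3I, VII_A 4.1] [cite: GortzWedhorn2020, Def. 4.45 (2) (p. 117)] -/
theorem comp_comp_relFrobeniusOver_eq_one_iff_comp_relFrobeniusOver_eq_one [Mono jG.left] {T : SchemeOver k} (t : T ⟶ G₀) :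
    (t ≫ jG) ≫ relFrobeniusOver p f X = 1 ↔ t ≫ relFrobeniusOver p f G₀ = 1 :=
  (comp_comp_relFrobeniusOver_eq_one_iff_unit p f jG t).trans (comp_relFrobeniusOver_eq_one_iff_unit p f t).symm

/-! ## §2 (hF-a) `t` killed by `F_{G₀}` iff `t` factors through `Spec (Γ(G₀) ⧸ ker Γ(ι_{Ker F}))` -/

omit [GrpObj X] [IsMonHom jG] in
set_option maxHeartbeats 400000 in
/-- **(hF-a) THE FROBENIUS KERNEL AS THE CLOSED SUBSCHEME OF ITS IDEAL**: for `G₀` affine and finite over `k` and a `T`-point `t` of `G₀`,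
`t ≫ F^{(f)}_{G₀∕k} = 1 ↔ ∃ s, s ≫ quotIncl G₀ 𝔎 = t`, `𝔎 := ker Γ(kerι F^{(f)}_{G₀})` (the P6c dictionary's `kerFI p f G₀`, by `rfl`): `Ker F ↪ G₀` is a closed
immersion (★ `isClosedImmersion_kerι_relFrobeniusOver_left`), so `Ker F ≅ Spec (Γ(G₀) ⧸ 𝔎)` over `G₀` (★ `exists_iso_comp_quotIncl_ker_appTop_eq`), and the
universal property of the kernel (★ `kerLift` ∕ `kerι_comp`). [cite: Waterhouse1979, §2.1] [cite: GortzWedhorn2020, Def. 4.45 (2) (p. 117)] -/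
theorem comp_relFrobeniusOver_eq_one_iff_exists_comp_quotIncl [IsAffine G₀.left] [IsFinite G₀.hom] {T : SchemeOver k} (t : T ⟶ G₀) :
    t ≫ relFrobeniusOver p f G₀ = 1 ↔
      ∃ s : T ⟶ _, s ≫ quotIncl G₀ (RingHom.ker (kerι (relFrobeniusOver p f G₀)).left.appTop.hom : Ideal (Alg G₀)) = t := by
  haveI := isMonHom_relFrobeniusOver p f G₀
  haveI := isClosedImmersion_kerι_relFrobeniusOver_left p f (G := G₀)
  haveI : IsAffine (ker (relFrobeniusOver p f G₀)).left := isAffine_of_isAffineHom (kerι (relFrobeniusOver p f G₀)).left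
  obtain ⟨e, he⟩ := exists_iso_comp_quotIncl_ker_appTop_eq (kerι (relFrobeniusOver p f G₀))
  refine ⟨fun h => ⟨kerLift t h ≫ e.hom, by rw [Category.assoc, he, kerLift_ι]⟩, ?_⟩
  · rintro ⟨s, rfl⟩
    have hq : quotIncl G₀ (RingHom.ker (kerι (relFrobeniusOver p f G₀)).left.appTop.hom : Ideal (Alg G₀)) =
        e.inv ≫ kerι (relFrobeniusOver p f G₀) := by rw [← cancel_epi e.hom, Iso.hom_inv_id_assoc]; exact he
    rw [hq, Category.assoc, Category.assoc, kerι_comp]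
    simp only [MonObj.comp_one]

/-! ## §3 (hF) The head: along `ι`, read in the ideal currency -/

/-- **(hF) THE DOCK FROBENIUS LAW, GENERIC** — for `ι : G₀ → X` a homomorphism of `k`-group schemes with `ι.left` mono, `G₀` affine and finite, and a
`T`-point `t` of `G₀`: `(t ≫ ι) ≫ F^{(f)}_{X∕k} = 1 ↔ ∃ s, s ≫ quotIncl G₀ (ker Γ(kerι F^{(f)}_{G₀})) = t` ((hF-b) ∘ (hF-a)).  At the P6 dock: `ι := ι₀G`,
`X := A_x̄`, the ideal is `kerFI p f G₀` by `rfl`. [cite: SGA3I, VII_A 4.1] [cite: Waterhouse1979, §2.1] [cite: GortzWedhorn2020, Def. 4.45 (2) (p. 117)] -/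
theorem comp_comp_relFrobeniusOver_eq_one_iff_exists_comp_quotIncl [Mono jG.left] [IsAffine G₀.left] [IsFinite G₀.hom]
    {T : SchemeOver k} (t : T ⟶ G₀) :
    (t ≫ jG) ≫ relFrobeniusOver p f X = 1 ↔
      ∃ s : T ⟶ _, s ≫ quotIncl G₀ (RingHom.ker (kerι (relFrobeniusOver p f G₀)).left.appTop.hom : Ideal (Alg G₀)) = t :=
  (comp_comp_relFrobeniusOver_eq_one_iff_comp_relFrobeniusOver_eq_one p f jG t).trans
    (comp_relFrobeniusOver_eq_one_iff_exists_comp_quotIncl p f t)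

end Literature.AlgebraicGeometry.GroupSchemes

end
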